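import Summits.BirchSwinnertonDyer.BirchSwinnertonDyer.Theorems.SignedLowerHalvesSmallImageLowerHalfBothSignsRttJunctionLambdaStrictDual
import HarnessLib

/-!
# Route `SignedLowerHalves`, crux L `SmallImageLowerHalfBothSigns` (stmt-BirchSwinnertonDyer-23599), line `rtt_w3` v22 → v23 — stub S3 / S3α: the strict Selmer dual
# `Y′ = Hom(Sel_{str at Σ}, ℚ/ℤ)` IS FINITELY GENERATED TORSION over `Λ` when `Dψ.X` is (the binders `[Module.Finite Λ Y′]`, `hY′` of the Ш-socket p782347 in S3α)

Stub hand `bsd-inputs-lambda-p1` g0 under LEAD `cruxlead-stmt-BirchSwinnertonDyer-23599` g12/g13 (cell `bsd-ssimc`); helper `--supports stmt-BirchSwinnertonDyer-23599`; THEOREMS ONLY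
(no definition, no named fact, no instance, no `sorry`); sequel of `…RttJunctionLambdaStrictDual` (p807576): `Y′` is a quotient of `Dψ.X` through the `Λ`-linear surjection `res`.
HONEST FRAMING: bookkeeping; S3 / E2 / crux L / BSD remain OPEN and are proved for NO curve. [cite: Washington1997, §13.2] [cite: Kobayashi2003, Thm. 7.3 i)]
-/

set_option autoImplicit false
set_option linter.dupNamespace false -- D-0017: single-problem summit, the namespace repeats the problem name by design
noncomputable section

open scoped Classical
open NumberField IsDedekindDomain Field

universe u

namespace Summit.BirchSwinnertonDyer.BirchSwinnertonDyer.Theorems.SmallImageRttD2Seq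

open Literature.NumberTheory.EllipticCurves Literature.NumberTheory.EllipticCurves.Kobayashi2003
  Literature.NumberTheory.EllipticCurves.GreenbergVatsal2000 Literature.NumberTheory.GaloisRepresentations
  Summit.BirchSwinnertonDyer.BirchSwinnertonDyer.Theorems.SmallImageCharSignedSelmer

/-! ## `Y′` is finitely generated torsion when `Dψ.X` is -/

section Finite

variable {K : Type u} [Field K] [NumberField K] {p : ℕ} [Fact p.Prime] {κ : ZpExtension K p} {γ : absoluteGaloisGroup K}
  {M : Type u} [AddCommGroup M] [DistribMulAction (absoluteGaloisGroup K) M] [TopologicalSpace M] [DiscreteTopology M] {R : Type*} [Ring R] [Module R M]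
  {V : WeierstrassCurve K} {j : V.geomPrimaryTorsion p →+ M} {S₀ : Set (HeightOneSpectrum (𝓞 K))} {ε : ℤˣ} (D : SignedTransportDualDataSat κ γ M R V j S₀ ε)
  (S₁ : Set (HeightOneSpectrum (𝓞 K)))

/-- **`Y′` is a finitely generated `Λ`-module** when `Dψ.X` is (a quotient of it through `res`). The binder `[Module.Finite Λ Y′]` of the Ш-socket
p782347 in S3α. [cite: Washington1997, §13.2] -/
theorem moduleFinite_strictDual (htor : ∀ m : M, ∃ k : ℕ, p ^ k • m = 0)
    (hstab : ∀ m : M, IsOpen (MulAction.stabilizer (absoluteGaloisGroup K) m : Set (absoluteGaloisGroup K))) (hγ : κ.IsTopGenerator γ)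
    [Module.Finite (IwasawaAlgebra p) D.X] :
    letI := strictDualModule κ R V j S₀ ε S₁ htor hstab hγ
    Module.Finite (IwasawaAlgebra p) (strictSelmer κ M R V j S₀ ε S₁ →+ AddCircle (1 : ℚ)) := by
  letI := strictDualModule κ R V j S₀ ε S₁ htor hstab hγ
  exact Module.Finite.of_surjective (resStrictLinearMap D S₁ htor hstab hγ) (resStrictHom_surjective D S₁)

/-- **`Y′` is `Λ`-torsion** when `Dψ.X` is (the hypothesis `htor` of the prefix). The binder `hY` of the Ш-socket p782347 in S3α. [cite: Washington1997, §13.2] -/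
theorem isTorsion_strictDual (htor : ∀ m : M, ∃ k : ℕ, p ^ k • m = 0)
    (hstab : ∀ m : M, IsOpen (MulAction.stabilizer (absoluteGaloisGroup K) m : Set (absoluteGaloisGroup K))) (hγ : κ.IsTopGenerator γ)
    (hX : Module.IsTorsion (IwasawaAlgebra p) D.X) :
    letI := strictDualModule κ R V j S₀ ε S₁ htor hstab hγ
    Module.IsTorsion (IwasawaAlgebra p) (strictSelmer κ M R V j S₀ ε S₁ →+ AddCircle (1 : ℚ)) := by
  letI := strictDualModule κ R V j S₀ ε S₁ htor hstab hγ
  intro y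
  obtain ⟨x, hx⟩ := resStrictHom_surjective D S₁ y
  obtain ⟨a, ha⟩ := @hX x
  refine ⟨a, ?_⟩; change (a : IwasawaAlgebra p) • y = 0
  rw [← hx, ← resStrictLinearMap_apply D S₁ htor hstab hγ, ← map_smul, show (a : IwasawaAlgebra p) • x = 0 from ha, map_zero]

end Finite

end Summit.BirchSwinnertonDyer.BirchSwinnertonDyer.Theorems.SmallImageRttD2Seq

end
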